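import Mathlib.Analysis.Calculus.LineDeriv.IntegrationByParts
import Mathlib.Analysis.Calculus.FDeriv.Symmetric
import Mathlib.Analysis.InnerProductSpace.PiL2
import Mathlib.MeasureTheory.Measure.Haar.InnerProductSpace
import HarnessLib

/-!
# Korn's identity for compactly supported vector fields
# (Chruściel–Delay 2003, (2.16), flat case)

For a `C²` compactly supported vector field `Y` on a finite-dimensional real inner product space
`E`, written in components `Y_j` along an orthonormal basis `b` (`∂ᵢ = D(·)(bᵢ)`),

* `integral_sum_fderiv_mul_fderiv_swap_eq` — `∫ Σᵢⱼ ∂ᵢYⱼ ∂ⱼYᵢ = ∫ (Σᵢ ∂ᵢYᵢ)²` (two integrations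
  by parts and the symmetry of second derivatives);
* `integral_symGradSq_eq` — **Korn's identity**
  `∫ Σᵢⱼ (½(∂ᵢYⱼ + ∂ⱼYᵢ))² = ½ ∫ Σᵢⱼ (∂ᵢYⱼ)² + ½ ∫ (div Y)²`;
* `integral_gradSq_le_two_mul_integral_symGradSq` — **Korn's inequality for compactly supported
  fields**: `∫ |∇Y|² ≤ 2 ∫ |∇₍ᵢYⱼ₎|²`.

This is the flat, boundaryless case of the identity
`∫ ∇₍ᵢYⱼ₎∇⁽ⁱYʲ⁾ = ½∫ (|∇Y|² + (div Y)² − Ric(Y,Y)) + ∮ …` in the proof of Lemma 2.7 of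
Chruściel–Delay (the coercivity of the adjoint `P*` of the linearised constraint map in the
vector field `Y`), the first analytic input of the isomorphism theorems of *loc. cit.*, §3.
The components `Y_j` are arbitrary `C²_c` scalar functions indexed by the basis. Everything is
proved; no statements of `Prop` type are introduced.

## References

* P. T. Chruściel, E. Delay, Mém. Soc. Math. Fr. 94 (2003), proof of Lemma 2.7, (2.16).
  [ChruscielDelay2003]
-/

noncomputable section

open Set Function Filter MeasureTheory
open scoped Topology ContDiff

namespace Literature.Analysis.PDE

namespace Korn

variable {E : Type*} [NormedAddCommGroup E] [InnerProductSpace ℝ E] [FiniteDimensional ℝ E]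
  [MeasurableSpace E] [BorelSpace E] {ι : Type*} [Fintype ι] (b : OrthonormalBasis ι ℝ E)

/-- **One integration by parts**: for `f ∈ C¹_c` and `g ∈ C¹`, `∫ ∂ₑf · g = −∫ f ∂ₑg`.
[folklore] -/
theorem integral_fderiv_mul_eq_neg {f g : E → ℝ} (hf : ContDiff ℝ 1 f) (hfc : HasCompactSupport f)
    (hg : ContDiff ℝ 1 g) (e : E) :
    ∫ x, fderiv ℝ f x e * g x = -∫ x, f x * fderiv ℝ g x e := by
  have hf0 : Continuous f := hf.continuous
  have hg0 : Continuous g := hg.continuous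
  have hdf : Continuous fun x ↦ fderiv ℝ f x e :=
    (hf.continuous_fderiv one_ne_zero).clm_apply continuous_const
  have hdg : Continuous fun x ↦ fderiv ℝ g x e :=
    (hg.continuous_fderiv one_ne_zero).clm_apply continuous_const
  have h := integral_mul_fderiv_eq_neg_fderiv_mul_of_integrable (μ := volume) (f := f) (g := g)
    (v := e) ?_ ?_ ?_ (fun x _ ↦ hf.differentiable one_ne_zero x)
    (fun x _ ↦ hg.differentiable one_ne_zero x)
  · rw [h, neg_neg]
  · exact (hdf.mul hg0).integrable_of_hasCompactSupport (hfc.fderiv_apply (𝕜 := ℝ) e).mul_right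
  · exact (hf0.mul hdg).integrable_of_hasCompactSupport hfc.mul_right
  · exact (hf0.mul hg0).integrable_of_hasCompactSupport hfc.mul_right

omit [FiniteDimensional ℝ E] [MeasurableSpace E] [BorelSpace E] in
/-- Symmetry of second directional derivatives of a `C²` function. [folklore] -/
theorem fderiv_fderiv_comm {f : E → ℝ} (hf : ContDiff ℝ 2 f) (x u w : E) :
    fderiv ℝ (fun y ↦ fderiv ℝ f y u) x w = fderiv ℝ (fun y ↦ fderiv ℝ f y w) x u := by
  have h1 : ∀ v, fderiv ℝ (fun y ↦ fderiv ℝ f y v) x = (fderiv ℝ (fderiv ℝ f) x).flip v := by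
    intro v
    have hd : DifferentiableAt ℝ (fderiv ℝ f) x :=
      (hf.fderiv_right (m := 1) (by norm_num)).differentiable one_ne_zero x
    rw [fderiv_clm_apply hd (differentiableAt_const v)]
    ext w'
    simp
  rw [h1 u, h1 w]
  simp only [ContinuousLinearMap.flip_apply]
  exact (hf.contDiffAt.isSymmSndFDerivAt (by simp)) w u

/-- **`∫ Σᵢⱼ ∂ᵢYⱼ ∂ⱼYᵢ = ∫ (Σᵢ ∂ᵢYᵢ)²`** for `C²_c` components `Y_j`.
[cite: ChruscielDelay2003, proof of Lemma 2.7, (2.16)] -/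
theorem integral_sum_fderiv_mul_fderiv_swap_eq {Y : ι → E → ℝ} (hY : ∀ j, ContDiff ℝ 2 (Y j))
    (hYc : ∀ j, HasCompactSupport (Y j)) :
    ∫ x, ∑ i, ∑ j, fderiv ℝ (Y j) x (b i) * fderiv ℝ (Y i) x (b j) =
      ∫ x, (∑ i, fderiv ℝ (Y i) x (b i)) ^ 2 := by
  have hY1 : ∀ j, ContDiff ℝ 1 (Y j) := fun j ↦ (hY j).of_le (by norm_num)
  have hY0 : ∀ j, Continuous (Y j) := fun j ↦ (hY j).continuous
  have hdY1 : ∀ j e, ContDiff ℝ 1 fun x ↦ fderiv ℝ (Y j) x e := fun j e ↦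
    ((hY j).fderiv_right (m := 1) (by norm_num)).clm_apply contDiff_const
  have hdY : ∀ j e, Continuous fun x ↦ fderiv ℝ (Y j) x e := fun j e ↦ (hdY1 j e).continuous
  have hdYc : ∀ j e, HasCompactSupport fun x ↦ fderiv ℝ (Y j) x e := fun j e ↦
    (hYc j).fderiv_apply (𝕜 := ℝ) e
  have hddY : ∀ j e e', Continuous fun x ↦ fderiv ℝ (fun y ↦ fderiv ℝ (Y j) y e) x e' :=
    fun j e e' ↦ ((hdY1 j e).continuous_fderiv one_ne_zero).clm_apply continuous_const
  -- each term: two integrations by parts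
  have hterm : ∀ i j, ∫ x, fderiv ℝ (Y j) x (b i) * fderiv ℝ (Y i) x (b j) =
      ∫ x, fderiv ℝ (Y j) x (b j) * fderiv ℝ (Y i) x (b i) := by
    intro i j
    calc ∫ x, fderiv ℝ (Y j) x (b i) * fderiv ℝ (Y i) x (b j)
        = -∫ x, Y j x * fderiv ℝ (fun y ↦ fderiv ℝ (Y i) y (b j)) x (b i) :=
          integral_fderiv_mul_eq_neg (hY1 j) (hYc j) (hdY1 i (b j)) (b i)
      _ = -∫ x, Y j x * fderiv ℝ (fun y ↦ fderiv ℝ (Y i) y (b i)) x (b j) := by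
          congr 1
          refine integral_congr_ae (Eventually.of_forall fun x ↦ ?_)
          simp only [fderiv_fderiv_comm (hY i) x (b j) (b i)]
      _ = ∫ x, fderiv ℝ (Y j) x (b j) * fderiv ℝ (Y i) x (b i) := by
          rw [integral_fderiv_mul_eq_neg (hY1 j) (hYc j) (hdY1 i (b i)) (b j)]
  have hint : ∀ i j e e', Integrable fun x ↦ fderiv ℝ (Y j) x e * fderiv ℝ (Y i) x e' :=
    fun i j e e' ↦ ((hdY j e).mul (hdY i e')).integrable_of_hasCompactSupport (hdYc j e).mul_right
  rw [integral_finsetSum _ fun i _ ↦ integrable_finsetSum _ fun j _ ↦ hint i j (b i) (b j)]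
  have h2 : ∀ i, ∫ x, ∑ j, fderiv ℝ (Y j) x (b i) * fderiv ℝ (Y i) x (b j) =
      ∫ x, ∑ j, fderiv ℝ (Y j) x (b j) * fderiv ℝ (Y i) x (b i) := fun i ↦ by
    rw [integral_finsetSum _ fun j _ ↦ hint i j (b i) (b j),
      integral_finsetSum _ fun j _ ↦ hint i j (b j) (b i)]
    exact Finset.sum_congr rfl fun j _ ↦ hterm i j
  simp_rw [h2]
  rw [← integral_finsetSum _ fun i _ ↦ integrable_finsetSum _ fun j _ ↦ hint i j (b j) (b i)]
  refine integral_congr_ae (Eventually.of_forall fun x ↦ ?_)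
  simp only [sq, Finset.sum_mul, Finset.mul_sum]

/-- **Korn's identity** for `C²_c` components `Y_j`:
`∫ Σᵢⱼ (½(∂ᵢYⱼ + ∂ⱼYᵢ))² = ½ ∫ Σᵢⱼ (∂ᵢYⱼ)² + ½ ∫ (Σᵢ ∂ᵢYᵢ)²`.
[cite: ChruscielDelay2003, proof of Lemma 2.7, (2.16)] -/
theorem integral_symGradSq_eq {Y : ι → E → ℝ} (hY : ∀ j, ContDiff ℝ 2 (Y j))
    (hYc : ∀ j, HasCompactSupport (Y j)) :
    ∫ x, ∑ i, ∑ j, ((fderiv ℝ (Y j) x (b i) + fderiv ℝ (Y i) x (b j)) / 2) ^ 2 =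
      (1 / 2) * (∫ x, ∑ i, ∑ j, fderiv ℝ (Y j) x (b i) ^ 2) +
        (1 / 2) * ∫ x, (∑ i, fderiv ℝ (Y i) x (b i)) ^ 2 := by
  have hdY : ∀ j e, Continuous fun x ↦ fderiv ℝ (Y j) x e := fun j e ↦
    ((hY j).continuous_fderiv (by norm_num)).clm_apply continuous_const
  have hdYc : ∀ j e, HasCompactSupport fun x ↦ fderiv ℝ (Y j) x e := fun j e ↦
    (hYc j).fderiv_apply (𝕜 := ℝ) e
  have hint : ∀ i j e e', Integrable fun x ↦ fderiv ℝ (Y j) x e * fderiv ℝ (Y i) x e' :=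
    fun i j e e' ↦ ((hdY j e).mul (hdY i e')).integrable_of_hasCompactSupport (hdYc j e).mul_right
  have hA : Integrable fun x ↦ ∑ i, ∑ j, fderiv ℝ (Y j) x (b i) ^ 2 := by
    refine integrable_finsetSum _ fun i _ ↦ integrable_finsetSum _ fun j _ ↦ ?_
    simp_rw [sq]
    exact hint j j (b i) (b i)
  have hB : Integrable fun x ↦ ∑ i, ∑ j, fderiv ℝ (Y j) x (b i) * fderiv ℝ (Y i) x (b j) :=
    integrable_finsetSum _ fun i _ ↦ integrable_finsetSum _ fun j _ ↦ hint i j (b i) (b j)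
  have hpt : ∀ x, ∑ i, ∑ j, ((fderiv ℝ (Y j) x (b i) + fderiv ℝ (Y i) x (b j)) / 2) ^ 2 =
      (1 / 2) * (∑ i, ∑ j, fderiv ℝ (Y j) x (b i) ^ 2) +
        (1 / 2) * ∑ i, ∑ j, fderiv ℝ (Y j) x (b i) * fderiv ℝ (Y i) x (b j) := by
    intro x
    have hswap : ∑ i, ∑ j, fderiv ℝ (Y i) x (b j) ^ 2 = ∑ i, ∑ j, fderiv ℝ (Y j) x (b i) ^ 2 := by
      rw [Finset.sum_comm]
    simp only [Finset.mul_sum, ← Finset.sum_add_distrib]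
    have h : ∀ i j, ((fderiv ℝ (Y j) x (b i) + fderiv ℝ (Y i) x (b j)) / 2) ^ 2 =
        (1 / 4) * fderiv ℝ (Y j) x (b i) ^ 2 + (1 / 4) * fderiv ℝ (Y i) x (b j) ^ 2 +
          (1 / 2) * (fderiv ℝ (Y j) x (b i) * fderiv ℝ (Y i) x (b j)) := fun i j ↦ by ring
    simp only [h, Finset.sum_add_distrib]
    rw [show ∑ i, ∑ j, (1 / 4 : ℝ) * fderiv ℝ (Y i) x (b j) ^ 2 =
      ∑ i, ∑ j, (1 / 4 : ℝ) * fderiv ℝ (Y j) x (b i) ^ 2 from Finset.sum_comm]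
    simp only [← Finset.sum_add_distrib]
    exact Finset.sum_congr rfl fun i _ ↦ Finset.sum_congr rfl fun j _ ↦ by ring
  simp_rw [hpt]
  rw [integral_add (hA.const_mul _) (hB.const_mul _), integral_const_mul, integral_const_mul,
    integral_sum_fderiv_mul_fderiv_swap_eq b hY hYc]

/-- **Korn's inequality for compactly supported fields**: `∫ Σᵢⱼ (∂ᵢYⱼ)² ≤ 2 ∫ Σᵢⱼ (∇₍ᵢYⱼ₎)²`.
[cite: ChruscielDelay2003, proof of Lemma 2.7, (2.16)] -/
theorem integral_gradSq_le_two_mul_integral_symGradSq {Y : ι → E → ℝ} (hY : ∀ j, ContDiff ℝ 2 (Y j))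
    (hYc : ∀ j, HasCompactSupport (Y j)) :
    ∫ x, ∑ i, ∑ j, fderiv ℝ (Y j) x (b i) ^ 2 ≤
      2 * ∫ x, ∑ i, ∑ j, ((fderiv ℝ (Y j) x (b i) + fderiv ℝ (Y i) x (b j)) / 2) ^ 2 := by
  rw [integral_symGradSq_eq b hY hYc]
  have h : 0 ≤ ∫ x, (∑ i, fderiv ℝ (Y i) x (b i)) ^ 2 := integral_nonneg fun x ↦ sq_nonneg _
  linarith

end Korn

end Literature.Analysis.PDE

end
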